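import Summits.QuantumFields.GaugeBoot.TwistedSlabFourLink
import HarnessLib

/-!
# Multilinear slab integrals: integrating out many block links at once (gauge-boot, L3 negative supplement; SU(3) link reflection at `β < 0`, part 2)

HONEST FRAMING (cell `pub-gaugeboot`, page 1 of every file): the venture produces certified bounds
on lattice expectations at stated coupling, gauge group, dimension and torus size; NOT a mass gap,
NOT a continuum limit, NOT a string tension; NOT Yang–Mills-summit-bearing (barriers
`FixedCouplingUltralocality`, `PerturbativeInvisibility`). Bookkeeping for a NEGATIVE structural
result (`FrameLinkRPNegativeBeta.lean`): link reflection positivity fails at every `β < 0` for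
three-dimensional representations of determinant one (`SU(3)`), `d ≥ 3`.

`TwistedSlabIntegral.slab_integral` integrates ONE plaquette observable (four block links, inside a
trace) against one-link class weights on a block. The baryonic witness of the negative-`β` result
is a contraction of SEVEN link variables with two `ε`-tensors, not a trace; this file provides the
general statement behind both: for a continuous inversion-invariant class weight `w` with
`wAvg ρ w = c • 1` (`TwistedSlabHaar.lean`), a block `S` of links, `m` DISTINCT block links
`t₀, …, t_{m-1}`, orientation flags `o_r` (`ρ(Y)` or `ρ(Y⁻¹)`), constants `L_r, R_r ∈ G` and entry
indices `γ_r, δ_r`,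

  `∫ ∏_{s ∈ S} w(Y_s) · ∏_r (ρ(L_r) ρ(Y_{t_r}^{±1}) ρ(R_r))_{γ_r δ_r} dμ(Y)
     = z^{|S| - m} c^m ∏_r ρ(L_r R_r)_{γ_r δ_r}`                    (`integral_prod_weight_mul_prod_entry`),

`z = ∫ w dk`, `μ` the product Haar measure: every integrated link variable between constant matrices
is replaced by `c · 1` (one-link identities `integral_weight_mul_entry(_inv)`), the other block
weights give `z` each (`integral_prod_weight`). Proof: induction on `m`, splitting off the link `t₀`
by independence of disjoint coordinate blocks (`LatticeRP.integral_mul_eq_of_dependsOn`).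
A finite-sum corollary `integral_prod_weight_mul_sum_prod_entry` handles observables given by an
entry expansion `∑_ι κ_ι ∏_r (…)_{γ_r(ι) δ_r(ι)}` (e.g. `Baryon.thetaForm_mul₃_eq_sum`).

Everything is `[folklore]` (Fubini and invariance of Haar measure; no character expansion).

References: K. Osterwalder, E. Seiler, Ann. Phys. 110 (1978) 440, §2; T. Bröcker, T. tom Dieck,
GTM 98 (1985), II §4; M. Creutz, Quarks, Gluons and Lattices (1983) Ch. 8.
-/

noncomputable section

open MeasureTheory Complex
open scoped Matrix ComplexConjugate
open Literature.MathematicalPhysics.QuantumFieldTheory (haarProbability)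
open Literature.MathematicalPhysics.QuantumFieldTheory.LatticeRP (integral_mul_eq_of_dependsOn
  integral_comp_eq_of_measurePreserving)
open Literature.RepresentationTheory.CompactGroups

namespace Summit.QuantumFields.GaugeBoot

namespace TwistedSlab

open TiltedRP

variable {A : Type*} [Fintype A] [DecidableEq A] {d N : ℕ}
variable {G : Type*} [Group G] [TopologicalSpace G] [IsTopologicalGroup G] [CompactSpace G]
  [MeasurableSpace G] [BorelSpace G] [SecondCountableTopology G] (ρ : G →* Matrix (Fin N) (Fin N) ℂ)

/-! ## Oriented link matrices -/

/-- `ρ(k)` (`o = false`) or `ρ(k⁻¹)` (`o = true`): the matrix a link variable contributes to a word,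
according to the orientation in which the word traverses the link. [folklore] -/
def repOr (o : Bool) (k : G) : Matrix (Fin N) (Fin N) ℂ := if o then ρ k⁻¹ else ρ k

omit [TopologicalSpace G] [IsTopologicalGroup G] [CompactSpace G] [MeasurableSpace G] [BorelSpace G]
  [SecondCountableTopology G] in
/-- `repOr` at `false`. [folklore] -/
@[simp] theorem repOr_false (k : G) : repOr ρ false k = ρ k := rfl

omit [TopologicalSpace G] [IsTopologicalGroup G] [CompactSpace G] [MeasurableSpace G] [BorelSpace G]
  [SecondCountableTopology G] in
/-- `repOr` at `true`. [folklore] -/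
@[simp] theorem repOr_true (k : G) : repOr ρ true k = ρ k⁻¹ := rfl

omit [TopologicalSpace G] [IsTopologicalGroup G] [CompactSpace G] [MeasurableSpace G] [BorelSpace G]
  [SecondCountableTopology G] in
/-- `repOr o 1 = 1`. [folklore] -/
@[simp] theorem repOr_one (o : Bool) : repOr ρ o (1 : G) = 1 := by
  cases o <;> simp [repOr]

omit [TopologicalSpace G] [IsTopologicalGroup G] [CompactSpace G] [MeasurableSpace G] [BorelSpace G]
  [SecondCountableTopology G] in
/-- A conjugated oriented link matrix: `ρ(L) · repOr o k · ρ(R) = repOr o (L k R)` or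
`repOr o (R⁻¹ k L⁻¹)`; in both cases it is `repOr o` of the link value `k' ` with
`ρ(L) ρ(k'^{±1}) ρ(R)`… — stated as the two identities used downstream. [folklore] -/
theorem mul_repOr_mul (o : Bool) (L k R : G) :
    ρ L * repOr ρ o k * ρ R = repOr ρ o (if o then R⁻¹ * k * L⁻¹ else L * k * R) := by
  cases o
  · simp [repOr, map_mul]
  · simp [repOr, map_mul, mul_inv_rev, mul_assoc]

omit [CompactSpace G] [MeasurableSpace G] [BorelSpace G] [SecondCountableTopology G] in
/-- `repOr` is continuous. [folklore] -/
theorem continuous_repOr (hρ : Continuous ρ) (o : Bool) : Continuous (repOr (G := G) ρ o) := by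
  cases o
  · have h : repOr (G := G) ρ false = fun k => ρ k := funext fun k => rfl
    rw [h]; exact hρ
  · have h : repOr (G := G) ρ true = fun k => ρ k⁻¹ := funext fun k => rfl
    rw [h]; exact hρ.comp continuous_inv

omit [CompactSpace G] [MeasurableSpace G] [BorelSpace G] [SecondCountableTopology G] [Fintype A]
  [DecidableEq A] in
/-- Continuity of a conjugated oriented link entry as a function of the configuration. [folklore] -/
theorem continuous_conj_repOr_entry (hρ : Continuous ρ) (o : Bool) (L R : G) (t : Link A d)
    (a b : Fin N) : Continuous fun Y : Config A d G => (ρ L * repOr ρ o (Y t) * ρ R) a b :=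
  CompactGroup.continuous_entry
    ((continuous_const.mul ((continuous_repOr ρ hρ o).comp (continuous_apply t))).mul
      continuous_const) a b

/-! ## The one-link identity with constant neighbours -/

omit [SecondCountableTopology G] in
/-- **One-link elimination between constant matrices**:
`∫ w(k) (ρ(L) ρ(k^{±1}) ρ(R))_{ab} dk = c · ρ(L R)_{ab}`. [folklore] -/
theorem integral_weight_mul_conj_repOr_entry {w : G → ℝ} (hw : Continuous w) (hinv : ∀ k, w k⁻¹ = w k)
    {c : ℂ} (hc : wAvg ρ w = c • (1 : Matrix (Fin N) (Fin N) ℂ)) (hρ : Continuous ρ) (o : Bool)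
    (L R : G) (a b : Fin N) :
    ∫ k, (w k : ℂ) * (ρ L * repOr ρ o k * ρ R) a b ∂(haarProbability G) = c * ρ (L * R) a b := by
  have hone : ∀ u v, ∫ k, (w k : ℂ) * repOr ρ o k u v ∂(haarProbability G) = if u = v then c else 0 := by
    intro u v
    cases o
    · simp only [repOr_false]
      exact integral_weight_mul_entry ρ hc u v
    · simp only [repOr_true]
      exact integral_weight_mul_entry_inv ρ hc hinv u v
  have hint : ∀ u v, Integrable (fun k => (w k : ℂ) * repOr ρ o k u v) (haarProbability G) :=
    fun u v => ((continuous_ofReal.comp hw).mul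
      (CompactGroup.continuous_entry (continuous_repOr ρ hρ o) u v)).integrable_of_hasCompactSupport
        (HasCompactSupport.of_compactSpace _)
  have hexp : ∀ k, (w k : ℂ) * (ρ L * repOr ρ o k * ρ R) a b =
      ∑ v, ∑ u, ρ L a u * ((w k : ℂ) * repOr ρ o k u v) * ρ R v b := by
    intro k
    rw [CompactGroup.conj_mul_apply, Finset.mul_sum]
    refine Finset.sum_congr rfl fun v _ => ?_
    rw [Finset.mul_sum]
    exact Finset.sum_congr rfl fun u _ => by ring
  simp_rw [hexp]
  rw [integral_finsetSum _ fun v _ => integrable_finsetSum _ fun u _ =>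
    ((hint u v).const_mul _).mul_const _]
  have h2 : ∀ v, ∫ k, ∑ u, ρ L a u * ((w k : ℂ) * repOr ρ o k u v) * ρ R v b ∂(haarProbability G) =
      c * (ρ L a v * ρ R v b) := by
    intro v
    rw [integral_finsetSum _ fun u _ => ((hint u v).const_mul _).mul_const _]
    have h3 : ∀ u, ∫ k, ρ L a u * ((w k : ℂ) * repOr ρ o k u v) * ρ R v b ∂(haarProbability G) =
        ρ L a u * (if u = v then c else 0) * ρ R v b := by
      intro u
      rw [integral_mul_const, integral_const_mul, hone u v]
    simp_rw [h3]
    simp only [mul_ite, mul_zero, ite_mul, zero_mul, Finset.sum_ite_eq', Finset.mem_univ, if_true]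
    ring
  simp_rw [h2]
  rw [← Finset.mul_sum, map_mul, Matrix.mul_apply]

/-! ## The multilinear slab integral -/

/-- **Multilinear slab integral.** For `m` distinct block links `t_r ∈ S`, orientations `o_r`,
constants `L_r, R_r` and entry indices `γ_r, δ_r`:
`∫ ∏_{s∈S} w(Y_s) · ∏_r (ρ(L_r) ρ(Y_{t_r}^{±1}) ρ(R_r))_{γ_r δ_r} dμ = z^{|S|-m} c^m ∏_r ρ(L_r R_r)_{γ_r δ_r}`
— each block variable standing between constant matrices is replaced by `c · 1`. [folklore] -/
theorem integral_prod_weight_mul_prod_entry {w : G → ℝ} (hw : Continuous w) (hinv : ∀ k, w k⁻¹ = w k)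
    {c : ℂ} (hc : wAvg ρ w = c • (1 : Matrix (Fin N) (Fin N) ℂ)) (hρ : Continuous ρ) :
    ∀ (m : ℕ) (S : Finset (Link A d)) (t : Fin m → Link A d), Function.Injective t → (∀ r, t r ∈ S) →
      ∀ (o : Fin m → Bool) (L R : Fin m → G) (γ δ : Fin m → Fin N),
      ∫ Y, (∏ s ∈ S, (w (Y s) : ℂ)) *
          ∏ r, (ρ (L r) * repOr ρ (o r) (Y (t r)) * ρ (R r)) (γ r) (δ r) ∂(productHaar A d G) =
        (∫ k, (w k : ℂ) ∂(haarProbability G)) ^ (S.card - m) * c ^ m *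
          ∏ r, ρ (L r * R r) (γ r) (δ r) := by
  intro m
  induction m with
  | zero =>
    intro S t _ _ o L R γ δ
    simp only [Finset.univ_eq_empty, Finset.prod_empty, mul_one, Nat.sub_zero, pow_zero]
    exact integral_prod_weight hw S
  | succ m ih =>
    intro S t ht htS o L R γ δ
    set s₀ := t 0 with hs₀
    have hmem : s₀ ∈ S := htS 0
    have hne : ∀ r : Fin m, t r.succ ≠ s₀ := fun r h => Fin.succ_ne_zero r (ht h)
    -- split the integrand into the `s₀`-part and the rest
    set f : Config A d G → ℂ := fun Y =>
      (w (Y s₀) : ℂ) * (ρ (L 0) * repOr ρ (o 0) (Y s₀) * ρ (R 0)) (γ 0) (δ 0) with hf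
    set g : Config A d G → ℂ := fun Y =>
      (∏ s ∈ S.erase s₀, (w (Y s) : ℂ)) *
        ∏ r : Fin m, (ρ (L r.succ) * repOr ρ (o r.succ) (Y (t r.succ)) * ρ (R r.succ)) (γ r.succ)
          (δ r.succ) with hg
    have hsplit : ∀ Y : Config A d G, (∏ s ∈ S, (w (Y s) : ℂ)) *
        ∏ r, (ρ (L r) * repOr ρ (o r) (Y (t r)) * ρ (R r)) (γ r) (δ r) = f Y * g Y := by
      intro Y
      rw [← Finset.mul_prod_erase S (fun s => (w (Y s) : ℂ)) hmem, Fin.prod_univ_succ, hf, hg]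
      ring
    simp_rw [hsplit]
    -- continuity
    have hfc : Continuous f :=
      (continuous_ofReal.comp (hw.comp (continuous_apply s₀))).mul
        (continuous_conj_repOr_entry ρ hρ (o 0) (L 0) (R 0) s₀ (γ 0) (δ 0))
    have hgc : Continuous g :=
      (continuous_finsetProd _ fun s _ => continuous_ofReal.comp (hw.comp (continuous_apply s))).mul
        (continuous_finsetProd _ fun r _ =>
          continuous_conj_repOr_entry ρ hρ (o r.succ) (L r.succ) (R r.succ) (t r.succ) (γ r.succ)
            (δ r.succ))
    -- independence of the `{s₀}` block and its complement
    have hind : ∫ Y, f Y * g Y ∂(productHaar A d G) =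
        (∫ Y, f Y ∂(productHaar A d G)) * ∫ Y, g Y ∂(productHaar A d G) := by
      unfold productHaar
      refine integral_mul_eq_of_dependsOn (haarProbability G) {s₀} (Finset.univ.erase s₀) ?_
        hfc.measurable hgc.measurable (fun Y Y' h => ?_) (fun Y Y' h => ?_)
      · rw [Finset.disjoint_singleton_left]; simp
      · simp only [hf]
        rw [h s₀ (by simp)]
      · have h1 : ∀ s ∈ S.erase s₀, Y s = Y' s := fun s hs =>
          h s (by simpa using (Finset.mem_erase.1 hs).1)
        have h2 : ∀ r : Fin m, Y (t r.succ) = Y' (t r.succ) := fun r => h _ (by simpa using hne r)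
        simp only [hg]
        rw [Finset.prod_congr rfl fun s hs => by rw [h1 s hs]]
        congr 1
        exact Finset.prod_congr rfl fun r _ => by rw [h2 r]
    -- the one-link integral
    have hone : ∫ Y, f Y ∂(productHaar A d G) = c * ρ (L 0 * R 0) (γ 0) (δ 0) := by
      rw [← integral_weight_mul_conj_repOr_entry ρ hw hinv hc hρ (o 0) (L 0) (R 0) (γ 0) (δ 0)]
      unfold productHaar
      exact integral_comp_eq_of_measurePreserving
        (measurePreserving_eval (fun _ : Link A d => haarProbability G) s₀)
        (Φ := fun k : G => (w k : ℂ) * (ρ (L 0) * repOr ρ (o 0) k * ρ (R 0)) (γ 0) (δ 0))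
        ((continuous_ofReal.comp hw).mul (CompactGroup.continuous_entry
          ((continuous_const.mul (continuous_repOr ρ hρ (o 0))).mul continuous_const) _ _)).measurable
    -- the rest: induction hypothesis on `S.erase s₀`
    have hrest : ∫ Y, g Y ∂(productHaar A d G) =
        (∫ k, (w k : ℂ) ∂(haarProbability G)) ^ ((S.erase s₀).card - m) * c ^ m *
          ∏ r : Fin m, ρ (L r.succ * R r.succ) (γ r.succ) (δ r.succ) :=
      ih (S.erase s₀) (fun r => t r.succ) (fun r r' h => Fin.succ_injective _ (ht h))
        (fun r => Finset.mem_erase.2 ⟨hne r, htS r.succ⟩) (fun r => o r.succ) (fun r => L r.succ)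
        (fun r => R r.succ) (fun r => γ r.succ) (fun r => δ r.succ)
    rw [hind, hone, hrest, Finset.card_erase_of_mem hmem, Fin.prod_univ_succ, pow_succ,
      show S.card - 1 - m = S.card - (m + 1) by omega]
    ring

/-- **Multilinear slab integral of an entry expansion**: for coefficients `κ_ι` and index maps
`γ_r(ι), δ_r(ι)` (`ι` in a finite index type),
`∫ ∏_{s∈S} w(Y_s) · ∑_ι κ_ι ∏_r (ρ(L_r) ρ(Y_{t_r}^{±1}) ρ(R_r))_{γ_r(ι) δ_r(ι)} dμ
   = z^{|S|-m} c^m ∑_ι κ_ι ∏_r ρ(L_r R_r)_{γ_r(ι) δ_r(ι)}`. [folklore] -/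
theorem integral_prod_weight_mul_sum_prod_entry {w : G → ℝ} (hw : Continuous w)
    (hinv : ∀ k, w k⁻¹ = w k) {c : ℂ} (hc : wAvg ρ w = c • (1 : Matrix (Fin N) (Fin N) ℂ))
    (hρ : Continuous ρ) {m : ℕ} (S : Finset (Link A d)) (t : Fin m → Link A d)
    (ht : Function.Injective t) (htS : ∀ r, t r ∈ S) (o : Fin m → Bool) (L R : Fin m → G)
    {I : Type*} [Fintype I] (κ : I → ℂ) (γ δ : Fin m → I → Fin N) :
    ∫ Y, (∏ s ∈ S, (w (Y s) : ℂ)) *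
        ∑ ι, κ ι * ∏ r, (ρ (L r) * repOr ρ (o r) (Y (t r)) * ρ (R r)) (γ r ι) (δ r ι)
          ∂(productHaar A d G) =
      (∫ k, (w k : ℂ) ∂(haarProbability G)) ^ (S.card - m) * c ^ m *
        ∑ ι, κ ι * ∏ r, ρ (L r * R r) (γ r ι) (δ r ι) := by
  have hwc : Continuous fun Y : Config A d G => ∏ s ∈ S, (w (Y s) : ℂ) :=
    continuous_finsetProd _ fun s _ => continuous_ofReal.comp (hw.comp (continuous_apply s))
  have hterm : ∀ ι, Continuous fun Y : Config A d G =>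
      (∏ s ∈ S, (w (Y s) : ℂ)) *
        (κ ι * ∏ r, (ρ (L r) * repOr ρ (o r) (Y (t r)) * ρ (R r)) (γ r ι) (δ r ι)) :=
    fun ι => hwc.mul (continuous_const.mul (continuous_finsetProd _ fun r _ =>
      continuous_conj_repOr_entry ρ hρ (o r) (L r) (R r) (t r) (γ r ι) (δ r ι)))
  simp_rw [Finset.mul_sum]
  rw [integral_finsetSum _ fun ι _ => integrable_config_of_continuous (hterm ι)]
  refine Finset.sum_congr rfl fun ι _ => ?_
  have h1 : ∀ Y : Config A d G, (∏ s ∈ S, (w (Y s) : ℂ)) *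
      (κ ι * ∏ r, (ρ (L r) * repOr ρ (o r) (Y (t r)) * ρ (R r)) (γ r ι) (δ r ι)) =
      κ ι * ((∏ s ∈ S, (w (Y s) : ℂ)) *
        ∏ r, (ρ (L r) * repOr ρ (o r) (Y (t r)) * ρ (R r)) (γ r ι) (δ r ι)) := fun Y => by ring
  simp_rw [h1]
  rw [integral_const_mul, integral_prod_weight_mul_prod_entry ρ hw hinv hc hρ m S t ht htS o L R
    (fun r => γ r ι) (fun r => δ r ι)]
  ring

end TwistedSlab

end Summit.QuantumFields.GaugeBoot

end
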